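import Mathlib
import HarnessLib

/-!
# The quarter-strip continuation `θ ↦ (cos θ)^{-β} F(tan θ)`

Topic `Literature/Analysis/Complex`. Everything here is PROVED (no named facts, no definitions).

Let `F` be holomorphic on the right half-plane `{Re t > 0}` with the power bound
`‖F t‖ ≤ C (Re t)^{-β}`, `β ≥ 0` — the shape produced by the Bernstein–Widder/Laplace
representation of a reflection-positive kernel in the normal variable. In the complexified polar
angle `θ` (`t = tan θ`) the function `Φ(θ) = (cos θ)^{-β} F(tan θ)` (principal branch) is
holomorphic on the open vertical strip `0 < Re θ < π/2`: there `Re cos θ = cos a cosh b > 0`, so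
`cos θ` lies in the slit plane, and `Re tan θ = sin a cos a / |cos θ|² > 0` (`θ = a + ib`).
On the real segment `(0, π/2)` it is the real formula `(cos θ)^{-β} F(tan θ)` (`Real.rpow`), and
it obeys the growth bound

  `‖Φ(a + ib)‖ ≤ C · (e^{|b|} / (sin a cos a))^β`,

since `|cos θ|^{-β} (Re tan θ)^{-β} = (|cos θ| / (sin a cos a))^β` and
`|cos(a+ib)|² = cos² a + sinh² b ≤ cosh² b ≤ e^{2|b|}`. This is the one-variable engine behind
"strip tiling" arguments that continue an angular profile known on two families of strips to an
entire function of exponential type `β` (see `StripTilingEntire.lean` in this directory).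

## References

* R. P. Boas, *Entire Functions* (1954), §1.1–§2.1 (exponential type; elementary growth of
  `cos`, `tan` in a strip). [folklore]
* The real/imaginary part formulas are Mathlib's `Complex.cos_eq`, `Complex.sin_eq`.
-/

noncomputable section

open Complex Set Filter Real

namespace Literature.Analysis.Complex

/-- **Quarter-strip continuation.** If `F` is holomorphic on the right half-plane with
`‖F t‖ ≤ C (Re t)^{-β}` (`β ≥ 0`), then there is `Φ` (namely `Φ(θ) = (cos θ)^{-β} F(tan θ)`,
principal branch) holomorphic on the strip `0 < Re θ < π/2`, equal to the real formula
`(cos θ)^{-β} F(tan θ)` for real `θ ∈ (0, π/2)`, with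
`‖Φ(a+ib)‖ ≤ C (e^{|b|} / (sin a cos a))^β`. Ingredients: `Re cos(a+ib) = cos a cosh b > 0` and
`Re tan(a+ib) = sin a cos a / |cos(a+ib)|² > 0` on the strip,
`|cos(a+ib)|² = cos²a + sinh²b ≤ cosh²b`, `cosh b ≤ e^{|b|}`. [folklore] -/
theorem exists_quarterStrip_continuation {β C : ℝ} {F : ℂ → ℂ} (hβ : 0 ≤ β)
    (hF : DifferentiableOn ℂ F {t : ℂ | 0 < t.re})
    (hFC : ∀ t : ℂ, 0 < t.re → ‖F t‖ ≤ C * t.re ^ (-β)) :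
    ∃ Φ : ℂ → ℂ, DifferentiableOn ℂ Φ {θ : ℂ | 0 < θ.re ∧ θ.re < π / 2} ∧
      (∀ θ : ℝ, 0 < θ → θ < π / 2 →
        Φ θ = ((Real.cos θ ^ (-β) : ℝ) : ℂ) * F ((Real.tan θ : ℝ) : ℂ)) ∧
      ∀ θ : ℂ, 0 < θ.re → θ.re < π / 2 →
        ‖Φ θ‖ ≤ C * (Real.exp |θ.im| / (Real.sin θ.re * Real.cos θ.re)) ^ β := by
  -- real and imaginary parts of `cos`, `sin`
  have hcre : ∀ θ : ℂ, (Complex.cos θ).re = Real.cos θ.re * Real.cosh θ.im := fun θ => by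
    rw [Complex.cos_eq θ]
    simp [Complex.cos_ofReal_re, Complex.sin_ofReal_re, Complex.cosh_ofReal_re,
      Complex.sinh_ofReal_re, Complex.cos_ofReal_im, Complex.sin_ofReal_im,
      Complex.cosh_ofReal_im, Complex.sinh_ofReal_im]
  have hcim : ∀ θ : ℂ, (Complex.cos θ).im = -(Real.sin θ.re * Real.sinh θ.im) := fun θ => by
    rw [Complex.cos_eq θ]
    simp [Complex.cos_ofReal_re, Complex.sin_ofReal_re, Complex.cosh_ofReal_re,
      Complex.sinh_ofReal_re, Complex.cos_ofReal_im, Complex.sin_ofReal_im,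
      Complex.cosh_ofReal_im, Complex.sinh_ofReal_im]
  have hsre : ∀ θ : ℂ, (Complex.sin θ).re = Real.sin θ.re * Real.cosh θ.im := fun θ => by
    rw [Complex.sin_eq θ]
    simp [Complex.cos_ofReal_re, Complex.sin_ofReal_re, Complex.cosh_ofReal_re,
      Complex.sinh_ofReal_re, Complex.cos_ofReal_im, Complex.sin_ofReal_im,
      Complex.cosh_ofReal_im, Complex.sinh_ofReal_im]
  have hsim : ∀ θ : ℂ, (Complex.sin θ).im = Real.cos θ.re * Real.sinh θ.im := fun θ => by
    rw [Complex.sin_eq θ]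
    simp [Complex.cos_ofReal_re, Complex.sin_ofReal_re, Complex.cosh_ofReal_re,
      Complex.sinh_ofReal_re, Complex.cos_ofReal_im, Complex.sin_ofReal_im,
      Complex.cosh_ofReal_im, Complex.sinh_ofReal_im]
  -- `|cos θ|² = cos² a + sinh² b ≤ cosh² b`, so `|cos θ| ≤ e^{|b|}`
  have hnsq : ∀ θ : ℂ,
      Complex.normSq (Complex.cos θ) = Real.cos θ.re ^ 2 + Real.sinh θ.im ^ 2 := fun θ => by
    rw [Complex.normSq_apply, hcre, hcim]
    nlinarith [Real.cosh_sq θ.im, Real.sin_sq θ.re]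
  have hnle : ∀ θ : ℂ, ‖Complex.cos θ‖ ≤ Real.exp |θ.im| := fun θ => by
    have hcosh : Real.cosh θ.im ≤ Real.exp |θ.im| := by
      rw [Real.cosh_eq]
      have h1 : Real.exp θ.im ≤ Real.exp |θ.im| := Real.exp_le_exp.2 (le_abs_self _)
      have h2 : Real.exp (-θ.im) ≤ Real.exp |θ.im| := Real.exp_le_exp.2 (neg_le_abs _)
      linarith
    refine le_trans ?_ hcosh
    have hsq : ‖Complex.cos θ‖ ^ 2 ≤ Real.cosh θ.im ^ 2 := by
      rw [Complex.sq_norm, hnsq, Real.cosh_sq]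
      nlinarith [Real.cos_sq_le_one θ.re]
    exact (sq_le_sq₀ (norm_nonneg _) (Real.cosh_pos _).le).1 hsq
  -- `Re tan θ = sin a cos a / |cos θ|²`
  have htan : ∀ θ : ℂ, (Complex.tan θ).re =
      Real.sin θ.re * Real.cos θ.re / Complex.normSq (Complex.cos θ) := fun θ => by
    rw [Complex.tan_eq_sin_div_cos, Complex.div_re, hsre, hcre, hsim, hcim, ← add_div]
    congr 1
    linear_combination Real.sin θ.re * Real.cos θ.re * Real.cosh_sq_sub_sinh_sq θ.im
  -- positivity on the strip
  have hpos : ∀ θ : ℂ, 0 < θ.re → θ.re < π / 2 →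
      0 < (Complex.cos θ).re ∧ 0 < Real.sin θ.re ∧ 0 < Real.cos θ.re := fun θ h1 h2 => by
    have hc : 0 < Real.cos θ.re := Real.cos_pos_of_mem_Ioo ⟨by linarith [Real.pi_pos], h2⟩
    exact ⟨by rw [hcre]; exact mul_pos hc (Real.cosh_pos _),
      Real.sin_pos_of_pos_of_lt_pi h1 (by linarith [Real.pi_pos]), hc⟩
  have hC : 0 ≤ C := by
    have := hFC 1 (by simp)
    simp only [Complex.one_re, Real.one_rpow, mul_one] at this
    exact (norm_nonneg _).trans this
  have hopen : IsOpen {t : ℂ | 0 < t.re} := isOpen_lt continuous_const Complex.continuous_re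
  refine ⟨fun θ => Complex.cos θ ^ (-(β : ℂ)) * F (Complex.tan θ), ?_, ?_, ?_⟩
  · rintro θ ⟨h1, h2⟩
    obtain ⟨hcre', hs, hc⟩ := hpos θ h1 h2
    have hslit : Complex.cos θ ∈ Complex.slitPlane := Complex.mem_slitPlane_iff.2 (Or.inl hcre')
    have hcos : Complex.cos θ ≠ 0 := Complex.slitPlane_ne_zero hslit
    have htre : 0 < (Complex.tan θ).re := by
      rw [htan]
      exact div_pos (mul_pos hs hc) (Complex.normSq_pos.2 hcos)
    refine DifferentiableAt.differentiableWithinAt ?_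
    refine ((Complex.differentiable_cos θ).cpow_const hslit).mul ?_
    exact (hF.differentiableAt (hopen.mem_nhds htre)).comp θ (Complex.differentiableAt_tan.2 hcos)
  · intro θ h1 h2
    have hc : 0 ≤ Real.cos θ := (Real.cos_pos_of_mem_Ioo ⟨by linarith [Real.pi_pos], h2⟩).le
    simp only [Complex.ofReal_cpow hc, Complex.ofReal_cos, Complex.ofReal_tan, Complex.ofReal_neg]
  · intro θ h1 h2
    obtain ⟨hcre', hs, hc⟩ := hpos θ h1 h2
    have hcos : Complex.cos θ ≠ 0 := fun h => by simp [h] at hcre'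
    have hn : 0 < ‖Complex.cos θ‖ := norm_pos_iff.2 hcos
    have htan' : (Complex.tan θ).re = Real.sin θ.re * Real.cos θ.re / ‖Complex.cos θ‖ ^ 2 := by
      rw [htan, Complex.normSq_eq_norm_sq]
    have htre : 0 < (Complex.tan θ).re := by rw [htan']; positivity
    have hle := hnle θ
    calc ‖Complex.cos θ ^ (-(β : ℂ)) * F (Complex.tan θ)‖
          = ‖Complex.cos θ‖ ^ (-β) * ‖F (Complex.tan θ)‖ := by
            rw [norm_mul, ← Complex.ofReal_neg, Complex.norm_cpow_real]
      _ ≤ ‖Complex.cos θ‖ ^ (-β) * (C * (Complex.tan θ).re ^ (-β)) :=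
            mul_le_mul_of_nonneg_left (hFC _ htre) (Real.rpow_nonneg hn.le _)
      _ = C * ((‖Complex.cos θ‖ * (Complex.tan θ).re) ^ (-β)) := by
            rw [Real.mul_rpow hn.le htre.le]; ring
      _ = C * ((Real.sin θ.re * Real.cos θ.re / ‖Complex.cos θ‖) ^ (-β)) := by
            rw [htan']; congr 2; field_simp
      _ = C * (‖Complex.cos θ‖ / (Real.sin θ.re * Real.cos θ.re)) ^ β := by
            rw [Real.rpow_neg (by positivity), ← Real.inv_rpow (by positivity), inv_div]
      _ ≤ C * (Real.exp |θ.im| / (Real.sin θ.re * Real.cos θ.re)) ^ β := by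
            gcongr

end Literature.Analysis.Complex
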